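import Summits.ResolutionOfSingularities.ResolutionOfSingularities.Theorems.ConeChainRoot
import HarnessLib

/-!
# PolygonLawKernel — «PolygonLaw» FILE A (decomp-res lens-4, g43) — LAW D: NO FORCED TOWER OF RING DIMENSION 3 (every class, every `p`, every field, every weight)

OURS (D-0178 root decomposition cell, residual mode; minimal-counterexample lens, generation 43; critic ROW 236 WINDOW g43 door (M1),
the MONOTONE door).  THE MONOTONE QUANTITY: Cossart–Jannsen–Saito's polygon measure `(β, e)` of the `μ`-prepared polygon
`Δ(f; u₁, u₂; y)` at the marked point (LNM 2270 Ch. 8 Def. 8.1/8.2, Ch. 13 Def. 13.1–13.3), which STRICTLY DESCENDS in a discrete ordered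
set along the completed chain of every infinite chain of `τ = 1` near points in an excellent regular threefold germ (Thm. 13.7, Lemmas
13.4–13.6; Cossart–Piltant 2008 Prop. 4.4 case `τ = 1`, p. 11; Cossart–Schober arXiv:1411.4452 Prop. 5.7) — PROVED IN THE KERNEL as the
tree's ring CONTRACT v3′ `Literature.AlgebraicGeometry.Resolution.false_of_fullChain_tau_one'` (res-inputs, `CompletedChainDescent`).
THIS FILE: §149 the SCHEME LAW `false_of_pointChain_tau_one` — an infinite chain of closed-point blow-ups of regular locally Noetherian
schemes, marked points of embedding dimension `3` with G-ring stalks, controlled transforms of control `μ ≥ 1`, order exactly `μ`, near,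
`τ = 1`, the marked point ISOLATED in `{ord ≥ μ}` at every level ⊢ `False` — discharged onto v3′ with EVERY step a point step (the
trichotomy from the tree's σ′ `CP2008Prop44.sigma'_congr`, the exceptional parameter by recursion, the weak transform as a colon, `L < δ` at
level `0` from isolation; NO codimension hypothesis on `V(𝓘)` — the `hcodim` binder of `CP2008Prop44.stub_T1` is needed only at curve
centres); §150 the TOWER LAW D `noTower_threefold` — NO forced tower has ring dimension `3` at every marked point, for EVERY class `P`
(`τ ≡ 1` by the landed LAW A `noTower_threefold_not_tauOne`, then §149 with isolation = the tower axiom `isolated`); §151 the root's PORT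
`SurfaceChainPort` (h640, CJS Thm. 6.40 for hypersurface point chains) PROVED from §149; §152 cells — the g42 located core (flagged doubly
narrow, a threefold class) KILLED ABSOLUTELY, the located residual re-located em-exactly onto the NON-THREEFOLD occult cells; §153 the root
with `hcore` and `h640` DROPPED (16 → 14 binders).  AI-written; AI review weaker than expert review.  `MaxContactCut.NoForcedTowers` and
resolution of singularities in dimension `≥ 4` / positive characteristic are NOT proved here: the non-threefold cells and the hugging /
latency / rider columns remain hypotheses of the root.  No named facts, no ports, no sorry.

THE QUANTITY AND ITS AUTHORSHIP (honesty).  The descent itself — `(β, e)` drops in a discrete well-ordered set at every point step of a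
`τ = 1` chain and cannot drop for ever — is res-inputs' kernel theorem `false_of_fullChain_tau_one'`, CALLED BY NAME (not copied, not
re-proved); the point-step trichotomy is the tree's `CP2008Prop44.sigma'_congr`, adapted coordinates / `μ! < δ` from isolation are the
Literature modules `AdaptedTauOneForms`, `IsolatedOrderPoint`.  Lens-4's kernel content is: (i) the CODIMENSION-FREE discharge §149 (the
scheme consumer on record, `CP2008Prop44.stub_T1`, carries `hcodim : ∀ z ∈ V(J_n), 1 < coheight z`, false on divisorial towers, and is
used only where a curve centre is permissible — a point-only chain never meets that branch); (ii) the tower LAW D for EVERY class; (iii) the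
port; (iv) the column closure below.  NOT CLAIMED: anything on towers with a marked point of ring dimension `4` (`DimFourAt`), on curve
centres, on dimension `≥ 4`, or on the structural ports `hMo hC hSL hP hM hRi`.

NON-VACUITY OF LAW D's HYPOTHESES AT FINITE LEVEL (paper standard; kernel not claimed).  Over ANY field `k`: `X_0 = 𝔸³_k = Spec k[u₁,u₂,y]`,
`x_0 =` the origin, `μ = 5`, `J_0 = (f)`, `f = y⁵ + u₁⁴u₂⁴`.  Then `ord_{x_0} f = 5` (`8 > 5`), `in₅ f = Y⁵` so `τ(x_0) = 1` (and the
port's cone clause holds with `z = y`, `c = 1`), `𝒪_{X_0,x_0}` is a G-ring (essentially of finite type over a field), embedding dimension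
`3`, and `x_0` is ISOLATED in `{ord ≥ 5}`: at a point `ξ ≠ x_0` of `V(f)` some `u_i` or `y` is a unit, e.g. on `V(y, u₁) ∖ {x_0}` one has
`ord_ξ f = ord_ξ(y⁵ + unit·u₁⁴) = 4 < 5`.  Blow up `x_0`; at the origin `x_1` of the `u₁`-chart (`y = u₁y′`, `u₂ = u₁u₂′`) the controlled
transform is `J_1 = (f′)`, `f′ = y′⁵ + u₁³u₂′⁴` of order `min(5, 7) = 5`: `x_1` is NEAR, again `τ(x_1) = 1`, isolated (exponents `3, 4 < 5`),
G-ring, embedding dimension `3`; once more `x_2` (origin of the next `u₁`-chart) carries `f″ = y″⁵ + u₁²u₂″⁴`, near, `τ = 1`, isolated.  So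
levels `0, 1, 2` of LAW D's hypotheses (and of the port's) are inhabited simultaneously; at level `3` the transform `y⁵ + u₁u₂⁴` has `τ = 3`
and the chain leaves the `τ = 1` habitat — as the law predicts, no INFINITE inhabitant exists.  (CJS Ch. 13 / CP2008 §4 standard model.)

REGISTRY CONSEQUENCE (on landing).  THE THREEFOLD COLUMN of the mixed residual is CLOSED — dead-for-cause, absolutely, in the kernel
(quantity = CJS `(β, e)`, res-inputs): CELL C₃ «occult divisorial threefold» (g34) and every located core cut out of it since g35 (line /
recurrent companion / curve-free / birth-recurrent / cofactor / narrow / flag / proper cone) are EMPTY; the port h640 `SurfaceChainPort`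
(= Literature `CJS2020_noInfiniteNearChain_eTwo`, CJS Thm. 6.40 «weaker than print») is DISCHARGED; the located residual after g43 is
`NoWildOccultNonThreefoldMixedTowers` = hC4 ∧ hD4 (ring dimension 4 expected habitat); the root has 14 binders.
-/

noncomputable section

set_option linter.dupNamespace false

open CategoryTheory CategoryTheory.Limits AlgebraicGeometry TopologicalSpace IsLocalRing MvPolynomial
open Literature.AlgebraicGeometry.Resolution Scheme.IdealSheafData
open Summit.ResolutionOfSingularities.ResolutionOfSingularities.Theorems
open WeakOrderReduction ForcedTowerClasses DivergentTowerClasses MonomialTowerClasses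
open HugDimensionClasses HugDimensionKernels SurfaceShadowClasses SurfaceShadowKernels
open NearPointCut (SingularClass)

namespace Summit.ResolutionOfSingularities.ResolutionOfSingularities.Theorems.HugValuationCut

universe u

/-! ## ══ FILE A `Theorems/PolygonLawKernel.lean` (§149–§150; imports the LANDED `ConeChainRoot`) ══ -/

section PointChainLaw

/-! ## §149 (g43 · NEW · KERNEL) SCHEME LAW D — no infinite chain of `τ = 1` closed-point blow-ups with isolated marked points in a regular
threefold germ (the point-only, codimension-free discharge of CONTRACT v3′) -/

set_option maxHeartbeats 1600000 in
/-- **SCHEME LAW D (PROVED).**  Data: locally Noetherian regular schemes `X_n`, blowings up `π_n : X_{n+1} → X_n` of the reduced closed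
points `x_n := π_n(y_n)`, `π_{n+1}(y_{n+1}) = y_n`, ideal sheaves `J_{n+1} =` controlled transform of `J_n` with control `μ ≥ 1`;
hypotheses, at every level: `ord_{x_n} J_n = μ`, embedding dimension `3` at `x_n`, `y_n` near, `τ(x_n) = 1`, `𝒪_{X_n,x_n}` a G-ring, and
`x_n` ISOLATED in `{ord ≥ μ}` (no non-maximal prime `𝔮 ⊂ 𝒪_{X_n,x_n}` with `J_n𝒪_𝔮 ⊆ (𝔮𝒪_𝔮)^μ`).  Conclusion: `False`.  Proof: the ring
CONTRACT v3′ `false_of_fullChain_tau_one'` (CJS Thm. 13.7: the polygon measure `(β, e)` descends) with every step a POINT step — trichotomy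
σ′, exceptional parameter by recursion, weak transform = colon, `μ! < δ` at level `0` from isolation; the curve clauses are vacuous.
[cite: CossartJannsenSaito2020, Thm. 13.7, Lemma 13.4, Lemma 13.6] [cite: CossartPiltant2008, Prop. 4.4 (proof, p. 11), Lemma 4.3 (5)] -/
theorem false_of_pointChain_tau_one (Xs : ℕ → Scheme.{u})
    (hN : ∀ n, IsLocallyNoetherian (Xs n)) (hXreg : ∀ n, Scheme.IsRegular (Xs n))
    (π : ∀ n, Xs (n + 1) ⟶ Xs n) (y : ∀ n, Xs (n + 1)) (J : ∀ n, (Xs n).IdealSheafData) {μ : ℕ} (hμ : 1 ≤ μ)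
    (hy : ∀ n, π (n + 1) (y (n + 1)) = y n)
    (hcl : ∀ n, IsClosed ({π n (y n)} : Set (Xs n)))
    (hπ : ∀ n, IsBlowup (π n) (vanishingIdeal ⟨{π n (y n)}, hcl n⟩))
    (hJ : ∀ n, J (n + 1) = controlledTransform (π n) (vanishingIdeal ⟨{π n (y n)}, hcl n⟩) (J n) μ)
    (hordx : ∀ n, idealOrder (J n) (π n (y n)) = μ)
    (hd : ∀ n, (maximalIdeal ((Xs n).presheaf.stalk (π n (y n)))).spanFinrank = 3)
    (hnear : ∀ n, IsNear (π n) (vanishingIdeal ⟨{π n (y n)}, hcl n⟩) (J n) μ (y n))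
    (hτ : ∀ n, @stalkTau (Xs n) (J n) (π n (y n)) (hXreg n (π n (y n))) μ = 1)
    (hG : ∀ n, IsGRing ((Xs n).presheaf.stalk (π n (y n))))
    (hisol : ∀ n (𝔮 : Ideal ((Xs n).presheaf.stalk (π n (y n)))) [𝔮.IsPrime], 𝔮 ≠ maximalIdeal _ →
      ¬ (stalkIdeal (J n) (π n (y n))).map (algebraMap _ (Localization.AtPrime 𝔮)) ≤
        maximalIdeal (Localization.AtPrime 𝔮) ^ μ) :
    False := by
  classical
  haveI := hN
  haveI hR : ∀ n, IsRegularLocalRing (chainRing Xs π y n) := fun n => hXreg n _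
  haveI hDom : ∀ n, IsDomain (chainRing Xs π y n) := fun n => isDomain_of_isRegularLocalRing _
  have rangeFin3 : ∀ {α : Type u} (c : Fin 3 → α), Set.range c = {c 0, c 1, c 2} := by
    intro α c
    ext a
    simp only [Set.mem_range, Set.mem_insert_iff, Set.mem_singleton_iff]
    constructor
    · rintro ⟨i, rfl⟩
      fin_cases i
      · exact Or.inl rfl
      · exact Or.inr (Or.inl rfl)
      · exact Or.inr (Or.inr rfl)
    · rintro (h | h | h) <;> exact ⟨_, h.symm⟩
  have hIμ : ∀ n, chainIdeal Xs π y J n ≤ maximalIdeal _ ^ μ := fun n =>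
    (le_idealOrder_iff (J n) (π n (y n)) μ).mp (hordx n).ge
  have hIne : ∀ n, ¬ chainIdeal Xs π y J n ≤ maximalIdeal _ ^ (μ + 1) := by
    intro n h
    have h' := (le_idealOrder_iff (J n) (π n (y n)) (μ + 1)).mpr h
    rw [hordx n] at h'
    exact absurd (by exact_mod_cast h' : μ + 1 ≤ μ) (by omega)
  have hdim : ∀ n, ringKrullDim (chainRing Xs π y n) = 3 := by
    intro n
    have h := (isRegularLocalRing_iff (chainRing Xs π y n)).mp inferInstance
    rw [hd n] at h
    exact_mod_cast h.symm
  have hτr : ∀ n (c : Fin 3 → chainRing Xs π y n), Ideal.span (Set.range c) = maximalIdeal _ →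
      hironakaTauAt c (chainIdeal Xs π y J n) μ = 1 := by
    intro n c hc
    rw [chainIdeal, ← stalkTau_eq (J n) (π n (y n)) μ (hd n) c hc]
    exact hτ n
  have hτ3 : ∀ n (c : Fin 3 → chainRing Xs π y n), Ideal.span {c 0, c 1, c 2} = maximalIdeal _ →
      hironakaTauAt c (chainIdeal Xs π y J n) μ = 1 := fun n c hc => hτr n c (by rw [rangeFin3]; exact hc)
  -- the centre is the reduced closed point: its stalk ideal at `x_n` is `𝔪`
  have hpt_P : ∀ n, stalkIdeal (vanishingIdeal (⟨{π n (y n)}, hcl n⟩ : Closeds (Xs n))) (π n (y n)) = maximalIdeal _ :=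
    fun n => stalkIdeal_vanishingIdeal_singleton (hcl n)
  have hcM : ∀ n, chainMap Xs π y hy n = stalkMapCongr (π n) (y n) (π (n + 1) (y (n + 1))) (hy n) := fun n => rfl
  -- the exceptional ideal is principal; the exceptional parameters by recursion
  have hexE : ∀ n, ∃ g : chainRing Xs π y (n + 1),
      (stalkIdeal (vanishingIdeal (⟨{π n (y n)}, hcl n⟩ : Closeds (Xs n))) (π n (y n))).map (chainMap Xs π y hy n) =
        Ideal.span {g} :=
    fun n => CP2008Prop44.exists_map_stalkIdeal_centre_eq_span_congr (hπ n) (π (n + 1) (y (n + 1))) (hy n)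
  obtain ⟨c₀, hc₀r, hc₀ad⟩ :=
    exists_rsop_forall_ne_zero_isAdapted_of_stalkTau_eq_one (J 0) (π 0 (y 0)) (hd 0) (hτ 0)
  let uStep : ∀ n, chainRing Xs π y n → chainRing Xs π y (n + 1) := fun n v =>
    if Ideal.span {chainMap Xs π y hy n v} = Ideal.span {Classical.choose (hexE n)} then chainMap Xs π y hy n v
    else Classical.choose (hexE n)
  let u : ∀ n, chainRing Xs π y n := fun n => Nat.rec (motive := fun n => chainRing Xs π y n) (c₀ 1) (fun n v => uStep n v) n
  have hu0 : u 0 = c₀ 1 := rfl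
  have husucc : ∀ n, u (n + 1) = uStep n (u n) := fun n => rfl
  have hE : ∀ n, (stalkIdeal (vanishingIdeal (⟨{π n (y n)}, hcl n⟩ : Closeds (Xs n))) (π n (y n))).map (chainMap Xs π y hy n) =
      Ideal.span {u (n + 1)} := by
    intro n
    rw [husucc]
    by_cases hc : Ideal.span {chainMap Xs π y hy n (u n)} = Ideal.span {Classical.choose (hexE n)}
    · simp only [uStep, hc, if_true]
      exact Classical.choose_spec (hexE n)
    · simp only [uStep, hc, if_false]
      exact Classical.choose_spec (hexE n)
  have hc₀3 : Ideal.span {c₀ 0, c₀ 1, c₀ 2} = maximalIdeal _ := by rw [← rangeFin3]; exact hc₀r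
  have hc₀ad' : ∀ G ∈ initialForms c₀ (chainIdeal Xs π y J 0) μ, ∃ a : ResidueField (chainRing Xs π y 0), G = C a * X 0 ^ μ :=
    forall_initialForms_eq_C_mul_X_pow_of_isAdapted c₀ (hτr 0 c₀ hc₀r) hc₀ad
  -- THE CONTRACT, every step a point step
  refine false_of_fullChain_tau_one' (fun n => chainRing Xs π y n) hdim (fun n => chainMap Xs π y hy n)
    (fun n => chainIdeal Xs π y J n) hμ u (fun _ => True) trivial hG c₀ hc₀3 hu0.symm hc₀ad' ?_ hIμ hIne hτ3
    (fun n => maximalIdeal _) ?_ (fun n h => absurd trivial h) ?_ ?_ (fun n h => absurd trivial h) (fun n h => absurd trivial h)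
    (fun n h => absurd trivial h) ?_ (fun n _ h => absurd trivial h) (fun n h => absurd trivial h) (fun n₀ => ⟨n₀, le_rfl, trivial⟩)
  · -- hδ₀ : `μ! < δ` at level `0`, from isolation (`L < μ!`, every adapted exponent lies in the slab)
    have hne := (pts_nonempty_and_alphaS_lt_of_isolated c₀ hc₀3 (hdim 0) (hisol 0)).1
    exact factorial_lt_deltaS_of_isAdapted c₀ hc₀3 (hdim 0) (hIμ 0) hne (hτr 0 c₀ hc₀r) hc₀ad
  · -- hexc_pt
    intro n _; rw [← hpt_P n]; exact hE n
  · -- hI : the weak transform is the colon by `u_{n+1}^μ`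
    intro n
    change stalkIdeal (J (n + 1)) (π (n + 1) (y (n + 1))) = _
    rw [hJ n]
    exact CP2008Prop44.stalkIdeal_controlledTransform_eq_colon_of_map_eq_span_congr _ (J n) μ _ (hy n) (u (n + 1)) (hE n)
  · -- hpt_cases : the trichotomy σ′ in the charts of an arbitrary adapted label
    intro n _ c hc3 had
    have hc : Ideal.span (Set.range c) = maximalIdeal _ := by rw [rangeFin3]; exact hc3
    have hcY : Ideal.span (Set.range c) = stalkIdeal (vanishingIdeal (⟨{π n (y n)}, hcl n⟩ : Closeds (Xs n))) (π n (y n)) := by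
      rw [hc, hpt_P]
    have hadI : ∀ i, i ≠ 0 → IsAdapted c (chainIdeal Xs π y J n) μ i := CP2008Prop44.bridge_isAdapted had
    rcases CP2008Prop44.sigma'_congr (hπ n) hμ (hd n) hc hcY (hτ n) hadI (hnear n) (π (n + 1) (y (n + 1))) (hy n) (hd (n + 1)) with
      ⟨a, c', h1, h0, h2, hgen', hsurj, -⟩ | ⟨t, Pq, c', h1, h0, ht, hmon, hP, hdeg, hirr, hres, hgen', -, hκ⟩ |
      ⟨c', h2, h0, h1, hgen', hsurj, -⟩
    · refine Or.inl ⟨hsurj, a, c' 0, c' 2, ?_, ?_, ?_⟩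
      · rw [hcM]; exact h0
      · rw [hcM]; exact h2
      · rw [h1] at hgen'; rw [hcM]; exact hgen'
    · refine Or.inr (Or.inl ⟨CP2008Prop44.not_surjective_residueField_map_of_two_le_natDegree _ hdeg hres, t, Pq, c' 0, ?_, ?_, hmon, hdeg,
        hirr, ?_, ?_, ?_⟩)
      · rw [hcM]; exact h0
      · rw [hcM]; exact ht
      · rw [hcM]; exact hres
      · rw [hcM]; exact hκ
      · rw [h1, hP] at hgen'; rw [hcM]; exact hgen'
    · refine Or.inr (Or.inr ⟨hsurj, c' 0, c' 1, ?_, ?_, ?_⟩)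
      · rw [hcM]; exact h0
      · rw [hcM]; exact h1
      · rw [h2] at hgen'; rw [hcM]; exact hgen'
  · -- hqis : isolation at every level
    intro n 𝔮 _ h𝔮 _
    exact hisol n 𝔮 h𝔮

end PointChainLaw

section ThreefoldLaw

variable {k : Type} [Field k]

/-! ## §150 (g43 · NEW · KERNEL) LAW D — THE POLYGON LAW: NO forced tower has ring dimension `3` at every marked point (every class `P`,
every `p`, every field, every weight `n ≥ 1`) -/

/-- **LAW D — THE POLYGON LAW (KERNEL, PROVED): there is NO forced tower of ring dimension `3`.**  If `τ(x_i) ≠ 1` at some stage the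
landed LAW A (`noTower_threefold_not_tauOne`: `τ = 2` propagates and Cossart–Piltant's case `τ = 2` forbids the chain) applies; else
`τ ≡ 1` and the tower is an infinite chain of `τ = 1` closed-point blow-ups with isolated marked points (tower axiom `isolated`) of excellent
regular threefold germs, which the scheme law §149 (CJS's polygon measure `(β, e)` descends: Thm. 13.7) forbids.
[cite: CossartJannsenSaito2020, Thm. 13.7] [cite: CossartPiltant2008, Prop. 4.4 (proof, p. 11), Lemma 4.3 (1), (3), (5)] -/
theorem noTower_threefold {n : ℕ} (hn : 1 ≤ n) (P : ForcedTower → Prop) :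
    NoTower n fun T => P T ∧ ThreefoldTower T := by
  intro p hp K _ _ T g hB hD hE hT
  obtain ⟨hP, h3⟩ := hT
  by_cases hτ1 : TauOneTower n T
  swap
  · exact noTower_threefold_not_tauOne hn P p hp K T g hB hD hE ⟨hP, h3, hτ1⟩
  have hNR := tower_isLocallyNoetherian_isRegular T g hB
  haveI : ∀ i, IsLocallyNoetherian (T.St i) := fun i => (hNR i).1
  have hτ := (tauOneTower_iff_towerTau T g hB n).mp hτ1
  exact false_of_pointChain_tau_one T.St (fun i => (hNR i).1) (tower_isRegular T g hB) T.π (fun i => T.pt (i + 1))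
    (fun i => (T.D i).ideal) hn (fun i => T.pt_map (i + 1)) (fun i => tower_isClosed_base T i)
    (fun i => tower_isBlowup_base T i) (fun i => tower_ideal_succ_eq_controlledTransform_base T hD i)
    (fun i => by rw [T.pt_map]; exact tower_idealOrder_pt_eq T g hB hD i)
    (fun i => tower_spanFinrank_eq_three_base T g hB h3 i) (fun i => tower_isNear_base T g hB hD i)
    (fun i => by
      have h := hτ i
      unfold towerTau at h
      rwa [CampaignW46.stalkTau_congr (tower_isRegular T g hB i) (T.D i).ideal n (T.pt_map i).symm] at h)
    (fun i => tower_isGRing_stalk T g hB i _) (fun i 𝔮 _ h𝔮 => tower_not_map_le_pow_base T hD i 𝔮 h𝔮)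

/-- **LAW D on the wild column** (`p ∣ n`, `n ≥ 1`). [folklore] -/
theorem noTowerWild_threefold {n : ℕ} (hn : 1 ≤ n) (P : ForcedTower → Prop) :
    NoTowerWild n fun T => P T ∧ ThreefoldTower T := by
  intro p hp hpn K _ _ T g hB hD hE hT
  exact noTower_threefold hn P p hp K T g hB hD hE hT

/-- **LAW D, class-free form**: no forced tower of weight `n ≥ 1` is a threefold tower. [folklore] -/
theorem noTower_threefoldTower {n : ℕ} (hn : 1 ≤ n) : NoTower n ThreefoldTower := by
  intro p hp K _ _ T g hB hD hE hT
  exact noTower_threefold hn (fun _ => True) p hp K T g hB hD hE ⟨trivial, hT⟩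

/-- **THE SURFACE COLUMN IS EMPTY, PORT-FREE** (g31's `noTower_surfaceColumn_of_port` without `SurfaceChainPort`): `SurfaceColumn n T`
entails `ThreefoldTower T`. [folklore] -/
theorem noTower_surfaceColumn {n : ℕ} (hn : 1 ≤ n) (P : ForcedTower → Prop) :
    NoTower n fun T => P T ∧ SurfaceColumn n T := by
  intro p hp K _ _ T g hB hD hE hT
  exact noTower_threefold hn P p hp K T g hB hD hE ⟨hT.1, hT.2.2.1⟩

end ThreefoldLaw

end Summit.ResolutionOfSingularities.ResolutionOfSingularities.Theorems.HugValuationCut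

end
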